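import Literature.Analysis.FluidPDE.TorusLinearisedNSVorticity
import Literature.Analysis.FluidPDE.PassiveScalarForcedGradientGrowth
import HarnessLib

/-!
# Gradient and Hessian growth of the planar linearised vorticity, uniformly in the viscosity,
# and the quantity inside the Beale–Kato–Majda logarithm

Analysis/FluidPDE proof file (theorems only; no definitions, no named facts), the composition of
`TorusLinearisedNSVorticity.lean` (the vorticity `ω = ∂₀w₁ − ∂₁w₀` of a classical solution of the
linearised Navier–Stokes equation `∂ₜw + (u·∇)w + (w·∇)u = νΔw − ∇q + g` on `T²` along a
divergence-free background `u` is a classical forced passive scalar with drift `u` and source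
`s = (∂₀g₁ − ∂₁g₀) − ⟪w, ∇Ω̄⟫`, `Ω̄ = ∂₀u₁ − ∂₁u₀`) with `PassiveScalarForcedGradientGrowth.lean` (the
`ν`-uniform `H¹`/`H²` energy estimates of the forced transport–diffusion equation):

* `Torus.laplacian_vorticity_eq_vorticity_laplacian_fin_two`, `Torus.gradNormSq_laplacian_eq_integral_laplacian_vorticity_sq_fin_two`,
  `Torus.gradNormSq_laplacian_le_two_mul_sum_fin_two` — for smooth divergence-free `w` on `T²`:
  `Δω = curl Δw`, `‖∇Δw‖₂² = ‖Δω‖₂² ≤ 2 ∑ᵢₖ ‖∂ᵢ∂ₖω‖₂²` (the planar identity `‖∇v‖₂ = ‖curl v‖₂` for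
  divergence-free `v`, applied to `v = Δw`; Majda–Bertozzi 2002 §3.2 / Ayala–Protas (2.4));
* `Torus.linearisedNSForced_sqrt_scalarGradNormSq_vorticity_le_exp_fin_two` — `ν ≥ 0`,
  `‖∂ₖu‖ ≤ Λ` on the window, `‖∇s(τ)‖₂ ≤ G(τ)`:
  `‖∇ω(t)‖₂ ≤ e^{2Λ(t−a)} (‖∇ω(a)‖₂ + ∫ₐᵗ G)`;
* `Torus.linearisedNSForced_sqrt_sum_vorticity_le_exp_fin_two` — with in addition `‖∂ᵢ∂ₖu‖ ≤ L₂`,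
  `‖∇ω(τ)‖₂ ≤ Y(τ)`, `(∑ᵢₖ‖∂ᵢ∂ₖs(τ)‖₂²)^{1/2} ≤ G(τ)`:
  `(∑ᵢₖ‖∂ᵢ∂ₖω(t)‖₂²)^{1/2} ≤ e^{8Λ(t−a)} ((∑ᵢₖ‖∂ᵢ∂ₖω(a)‖₂²)^{1/2} + ∫ₐᵗ (4L₂Y + G))`;
* `Torus.linearisedNSForced_sqrt_gradNormSq_laplacian_le_fin_two` — consequently
  `‖∇Δw(t)‖₂ ≤ √2 · e^{8Λ(t−a)} ((∑ᵢₖ‖∂ᵢ∂ₖω(a)‖₂²)^{1/2} + ∫ₐᵗ (4L₂Y + G))` — the quantity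
  `√(gradNormSq (Δw))` that enters the logarithm of the planar Beale–Kato–Majda bound
  `Torus.exists_sqrt_gradSq_le_bkm_log_homogeneous_fin_two` grows at most exponentially with a rate
  set by `sup‖∇u‖` and NOT by `ν⁻¹`.

All constants displayed; uniform in `ν ≥ 0`. The source bounds `G`, `Y` are hypotheses (for the
sawtooth cascade `s = rate · U″(x₂) · w₁`, `SawtoothCascadeResponseVorticity.lean`).

## Mathlib / tree search

Tree (reused): `Torus.linearisedNSForced_isClassicalScalarTransportForcedOn_vorticity_fin_two`,
`Torus.integral_vorticity_sq_eq_gradNormSq_fin_two` (`TorusLinearisedNSVorticity`);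
`IsClassicalScalarTransportForcedOn.sqrt_scalarGradNormSq_le_exp`, `.sqrt_hessSq_le_exp`,
`Torus.integral_laplacian_sq_le_card_mul_sum` (`PassiveScalarForcedGradientGrowth`);
`Torus.IsDivFree.laplacian_of_isSmooth`, `Torus.partialDeriv_laplacian_comm`, `Torus.laplacian_add_apply`,
`Torus.laplacian_const_smul_apply`. The coordinate lemmas `laplacian_apply_coord` /
`laplacian_torusVorticityTensor` are file-private copies of the private helpers of
`TorusLinearisedNSVorticity`. Searched `laplacian_vorticity`, `gradNormSq_laplacian_eq`, `vorticity.*le_exp`: nothing.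

## References

* A. J. Majda, A. L. Bertozzi, *Vorticity and Incompressible Flow*, CUP 2002, §3.2 Prop. 3.7
  (the `H^m` energy estimate, uniform in `ν`), §2.1 (2.5)–(2.6). [MajdaBertozzi2002]
* R. Shvydkoy, Y. Latushkin, J. Math. Fluid Mech. 7 (2005), §2 (vorticity form of the linearised
  operator). [ShvydkoyLatushkin2005]
* D. Ayala, B. Protas, J. Fluid Mech. 818 (2017), (2.3)–(2.4). [AyalaProtas2017]
-/

noncomputable section

open Set MeasureTheory Finset
open scoped ContDiff InnerProductSpace RealInnerProductSpace

namespace Literature.Analysis.FluidPDE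

namespace Torus

open Literature.Analysis.FunctionSpaces
open Literature.Analysis.FunctionSpaces.Torus

variable {d : Type*} [Fintype d] [DecidableEq d]

namespace LinearisedVorticityGrowth

omit [DecidableEq d] in
/-- Coordinates of the vector Laplacian: `(Δv)ⱼ = Δ(vⱼ)` for smooth `v`. [folklore] -/
private theorem laplacian_apply_coord {v : UnitAddTorus d → EuclideanSpace ℝ d}
    (hv : Torus.IsSmooth v) (x : UnitAddTorus d) (j : d) :
    Torus.laplacian v x j = Torus.laplacian (fun y => v y j) x := by
  have h2 : ContDiffAt ℝ 2 (Torus.liftAt v x) 0 :=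
    ((hv.liftAt x).of_le (WithTop.coe_le_coe.mpr le_top)).contDiffAt
  have key := h2.laplacian_CLM_comp_left
    (l := (EuclideanSpace.proj j : EuclideanSpace ℝ d →L[ℝ] ℝ))
  have hl : Torus.liftAt (fun y => v y j) x =
      (EuclideanSpace.proj j : EuclideanSpace ℝ d →L[ℝ] ℝ) ∘ Torus.liftAt v x := rfl
  simp only [Torus.laplacian, hl, key, Function.comp_apply]
  rfl

/-- `ΔWᵢⱼ(v) = Wᵢⱼ(Δv)` for smooth `v` (derivatives commute). [folklore] -/
private theorem laplacian_torusVorticityTensor {v : UnitAddTorus d → EuclideanSpace ℝ d}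
    (hv : Torus.IsSmooth v) (i j : d) (x : UnitAddTorus d) :
    Torus.laplacian (torusVorticityTensor v i j) x = torusVorticityTensor (Torus.laplacian v) i j x := by
  have hi : Torus.IsSmooth (fun y => Torus.partialDeriv i v y j) := (hv.partialDeriv i).apply j
  have hj : Torus.IsSmooth (fun y => Torus.partialDeriv j v y i) := (hv.partialDeriv j).apply i
  have hfun : torusVorticityTensor v i j =
      (fun y => Torus.partialDeriv i v y j) + (-1 : ℝ) • fun y => Torus.partialDeriv j v y i := by
    funext y; simp [torusVorticityTensor, sub_eq_add_neg]
  rw [hfun, Torus.laplacian_add_apply hi (hj.smul (-1)), Torus.laplacian_const_smul_apply hj,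
    ← laplacian_apply_coord (hv.partialDeriv i), ← laplacian_apply_coord (hv.partialDeriv j),
    ← Torus.partialDeriv_laplacian_comm hv i, ← Torus.partialDeriv_laplacian_comm hv j, smul_eq_mul,
    torusVorticityTensor]
  ring

end LinearisedVorticityGrowth

open LinearisedVorticityGrowth

/-! ### Part 1. `‖∇Δw‖₂ = ‖Δω‖₂` on `T²` -/

/-- **`Δω = curl Δw` on `T²`**: for smooth `w`, `Δ(∂₀w₁ − ∂₁w₀) = ∂₀(Δw)₁ − ∂₁(Δw)₀`.
[cite: MajdaBertozzi2002, §2.1 eqs. (2.5)–(2.6) (vorticity equation: curl commutes with Δ)] -/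
theorem laplacian_vorticity_eq_vorticity_laplacian_fin_two
    {w : UnitAddTorus (Fin 2) → EuclideanSpace ℝ (Fin 2)} (hw : Torus.IsSmooth w) (x : UnitAddTorus (Fin 2)) :
    Torus.laplacian (torusVorticityTensor w 0 1) x = torusVorticityTensor (Torus.laplacian w) 0 1 x :=
  laplacian_torusVorticityTensor hw 0 1 x

/-- **`‖∇Δw‖₂² = ‖Δω‖₂²` on `T²`** for smooth divergence-free `w` (`Δw` is smooth and divergence
free, `curl Δw = Δω`, and `‖∇v‖₂ = ‖curl v‖₂` for divergence-free planar `v`, tree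
`integral_vorticity_sq_eq_gradNormSq_fin_two`). [cite: AyalaProtas2017, eqs. (2.3)–(2.4)] -/
theorem gradNormSq_laplacian_eq_integral_laplacian_vorticity_sq_fin_two
    {w : UnitAddTorus (Fin 2) → EuclideanSpace ℝ (Fin 2)} (hw : Torus.IsSmooth w) (hdiv : Torus.IsDivFree w) :
    Torus.gradNormSq (Torus.laplacian w) = ∫ x, (Torus.laplacian (torusVorticityTensor w 0 1) x) ^ 2 := by
  rw [← integral_vorticity_sq_eq_gradNormSq_fin_two hw.laplacian (IsDivFree.laplacian_of_isSmooth hw hdiv)]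
  refine integral_congr_ae (ae_of_all _ fun x => ?_)
  simp only [laplacian_vorticity_eq_vorticity_laplacian_fin_two hw x]

/-- **`‖∇Δw‖₂² ≤ 2 ∑ᵢₖ ‖∂ᵢ∂ₖω‖₂²` on `T²`** for smooth divergence-free `w` (previous identity and
`‖Δω‖₂² ≤ 2∑ᵢₖ‖∂ᵢ∂ₖω‖₂²`). [cite: MajdaBertozzi2002, §3.2 Prop. 3.7 (calculus of the H^m energy estimate)] -/
theorem gradNormSq_laplacian_le_two_mul_sum_fin_two
    {w : UnitAddTorus (Fin 2) → EuclideanSpace ℝ (Fin 2)} (hw : Torus.IsSmooth w) (hdiv : Torus.IsDivFree w) :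
    Torus.gradNormSq (Torus.laplacian w) ≤ 2 * ∑ i, ∑ k, ∫ x,
      (Torus.partialDeriv i (Torus.partialDeriv k (torusVorticityTensor w 0 1)) x) ^ 2 := by
  rw [gradNormSq_laplacian_eq_integral_laplacian_vorticity_sq_fin_two hw hdiv]
  have hω : Torus.IsSmooth (torusVorticityTensor w 0 1) :=
    ((hw.partialDeriv 0).apply 1).sub ((hw.partialDeriv 1).apply 0)
  have h := integral_laplacian_sq_le_card_mul_sum hω
  have e : (Fintype.card (Fin 2) : ℝ) = 2 := by simp
  rw [e] at h
  exact h

/-! ### Part 2. Growth of `‖∇ω‖₂`, of `∑‖∂ᵢ∂ₖω‖₂²` and of `‖∇Δw‖₂` along the linearised flow -/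

variable {a b ν : ℝ} {u w g : ℝ → UnitAddTorus (Fin 2) → EuclideanSpace ℝ (Fin 2)}
  {q : ℝ → UnitAddTorus (Fin 2) → ℝ}

/-- **Gradient growth of the planar linearised vorticity, uniformly in `ν ≥ 0`.** For a classical
divergence-free solution `(w, q)` of `∂ₜw + (u·∇)w + (w·∇)u = νΔw − ∇q + g` on `[a, b] × T²` along a
smooth divergence-free `u` with `‖∂ₖu(τ, x)‖ ≤ Λ`, and a continuous `G ≥ 0` with
`‖∇s(τ)‖₂ ≤ G(τ)` for the vorticity source `s = (∂₀g₁ − ∂₁g₀) − ⟪w, ∇Ω̄⟫`: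
`‖∇ω(t)‖₂ ≤ e^{2Λ(t−a)} (‖∇ω(a)‖₂ + ∫ₐᵗ G)` for `t ∈ [a, b]`, `ω = ∂₀w₁ − ∂₁w₀`.
[cite: MajdaBertozzi2002, §3.2 Prop. 3.7 (3.58)–(3.60) (H^m energy estimate uniform in the viscosity; m = 1, linearised vorticity form)] -/
theorem linearisedNSForced_sqrt_scalarGradNormSq_vorticity_le_exp_fin_two
    (hu : Torus.IsSmoothSpaceTimeOn (Icc a b) u) (hudiv : ∀ t ∈ Icc a b, Torus.IsDivFree (u t))
    (hw : Torus.IsSmoothSpaceTimeOn (Icc a b) w) (hq : Torus.IsSmoothSpaceTimeOn (Icc a b) q)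
    (hwdiv : ∀ t ∈ Icc a b, Torus.IsDivFree (w t))
    (hlin : ∀ t ∈ Icc a b, ∀ x, Torus.timeDerivWithin (Icc a b) w t x + Torus.convect (u t) (w t) x +
      Torus.convect (w t) (u t) x = ν • Torus.laplacian (w t) x - Torus.gradient (q t) x + g t x)
    (hab : a < b) (hν : 0 ≤ ν) {Λ : ℝ} (hΛ : 0 ≤ Λ)
    (hL : ∀ τ ∈ Icc a b, ∀ x, ∀ k, ‖Torus.partialDeriv k (u τ) x‖ ≤ Λ)
    {G : ℝ → ℝ} (hGc : ContinuousOn G (Icc a b)) (hG0 : ∀ τ ∈ Icc a b, 0 ≤ G τ)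
    (hsG : ∀ τ ∈ Icc a b, Real.sqrt (scalarGradNormSq (fun x =>
      (Torus.partialDeriv 0 (g τ) x 1 - Torus.partialDeriv 1 (g τ) x 0) -
        ⟪w τ x, Torus.gradient (torusVorticityTensor (u τ) 0 1) x⟫_ℝ)) ≤ G τ)
    {t : ℝ} (ht : t ∈ Icc a b) :
    Real.sqrt (scalarGradNormSq (torusVorticityTensor (w t) 0 1)) ≤
      Real.exp (2 * Λ * (t - a)) *
        (Real.sqrt (scalarGradNormSq (torusVorticityTensor (w a) 0 1)) + ∫ τ in a..t, G τ) := by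
  have h := linearisedNSForced_isClassicalScalarTransportForcedOn_vorticity_fin_two hu hudiv hw hq hwdiv
    hlin hab
  have key := h.sqrt_scalarGradNormSq_le_exp hν Subset.rfl hΛ hL hGc hG0 hsG ht
  have e : (Fintype.card (Fin 2) : ℝ) = 2 := by simp
  rw [e] at key
  exact key

/-- **Hessian growth of the planar linearised vorticity, uniformly in `ν ≥ 0`.** Under the
hypotheses of `linearisedNSForced_sqrt_scalarGradNormSq_vorticity_le_exp_fin_two`, with in addition
`‖∂ᵢ∂ₖu(τ, x)‖ ≤ L₂`, a continuous `Y` with `‖∇ω(τ)‖₂ ≤ Y(τ)` and a continuous `G ≥ 0` with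
`(∑ᵢₖ ‖∂ᵢ∂ₖs(τ)‖₂²)^{1/2} ≤ G(τ)`:
`(∑ᵢₖ ‖∂ᵢ∂ₖω(t)‖₂²)^{1/2} ≤ e^{8Λ(t−a)} ((∑ᵢₖ ‖∂ᵢ∂ₖω(a)‖₂²)^{1/2} + ∫ₐᵗ (4L₂Y + G))`.
[cite: MajdaBertozzi2002, §3.2 Prop. 3.7 (3.58)–(3.60) (H^m energy estimate uniform in the viscosity; m = 2, linearised vorticity form)] -/
theorem linearisedNSForced_sqrt_sum_vorticity_le_exp_fin_two
    (hu : Torus.IsSmoothSpaceTimeOn (Icc a b) u) (hudiv : ∀ t ∈ Icc a b, Torus.IsDivFree (u t))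
    (hw : Torus.IsSmoothSpaceTimeOn (Icc a b) w) (hq : Torus.IsSmoothSpaceTimeOn (Icc a b) q)
    (hwdiv : ∀ t ∈ Icc a b, Torus.IsDivFree (w t))
    (hlin : ∀ t ∈ Icc a b, ∀ x, Torus.timeDerivWithin (Icc a b) w t x + Torus.convect (u t) (w t) x +
      Torus.convect (w t) (u t) x = ν • Torus.laplacian (w t) x - Torus.gradient (q t) x + g t x)
    (hab : a < b) (hν : 0 ≤ ν) {Λ L₂ : ℝ} (hΛ : 0 ≤ Λ) (hL₂ : 0 ≤ L₂)
    (hL : ∀ τ ∈ Icc a b, ∀ x, ∀ k, ‖Torus.partialDeriv k (u τ) x‖ ≤ Λ)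
    (hLL : ∀ τ ∈ Icc a b, ∀ x, ∀ i k, ‖Torus.partialDeriv i (Torus.partialDeriv k (u τ)) x‖ ≤ L₂)
    {Y : ℝ → ℝ} (hYc : ContinuousOn Y (Icc a b))
    (hY : ∀ τ ∈ Icc a b, Real.sqrt (scalarGradNormSq (torusVorticityTensor (w τ) 0 1)) ≤ Y τ)
    {G : ℝ → ℝ} (hGc : ContinuousOn G (Icc a b)) (hG0 : ∀ τ ∈ Icc a b, 0 ≤ G τ)
    (hsG : ∀ τ ∈ Icc a b, Real.sqrt (∑ i, ∑ k, ∫ x, (Torus.partialDeriv i (Torus.partialDeriv k (fun y =>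
      (Torus.partialDeriv 0 (g τ) y 1 - Torus.partialDeriv 1 (g τ) y 0) -
        ⟪w τ y, Torus.gradient (torusVorticityTensor (u τ) 0 1) y⟫_ℝ)) x) ^ 2) ≤ G τ)
    {t : ℝ} (ht : t ∈ Icc a b) :
    Real.sqrt (∑ i, ∑ k, ∫ x,
        (Torus.partialDeriv i (Torus.partialDeriv k (torusVorticityTensor (w t) 0 1)) x) ^ 2) ≤
      Real.exp (8 * Λ * (t - a)) *
        (Real.sqrt (∑ i, ∑ k, ∫ x,
            (Torus.partialDeriv i (Torus.partialDeriv k (torusVorticityTensor (w a) 0 1)) x) ^ 2) +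
          ∫ τ in a..t, (4 * L₂ * Y τ + G τ)) := by
  have h := linearisedNSForced_isClassicalScalarTransportForcedOn_vorticity_fin_two hu hudiv hw hq hwdiv
    hlin hab
  have key := h.sqrt_hessSq_le_exp hν Subset.rfl hΛ hL₂ hL hLL hYc hY hGc hG0 hsG ht
  have e : (Fintype.card (Fin 2) : ℝ) = 2 := by simp
  rw [e] at key
  have e4 : ((2 : ℝ) ^ 2) = 4 := by norm_num
  simp only [e4] at key
  have e8 : (2 : ℝ) * 4 = 8 := by norm_num
  simp only [e8] at key
  exact key

/-- **The quantity inside the Beale–Kato–Majda logarithm grows at most exponentially, at a rate set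
by `sup‖∇u‖`, uniformly in `ν ≥ 0`.** Under the hypotheses of
`linearisedNSForced_sqrt_sum_vorticity_le_exp_fin_two`, for `t ∈ [a, b]`:
`‖∇Δw(t)‖₂ ≤ √2 · e^{8Λ(t−a)} ((∑ᵢₖ ‖∂ᵢ∂ₖω(a)‖₂²)^{1/2} + ∫ₐᵗ (4L₂Y + G))`
(`‖∇Δw‖₂² = ‖Δω‖₂² ≤ 2∑‖∂ᵢ∂ₖω‖₂²`). Feed this into
`Torus.exists_sqrt_gradSq_le_bkm_log_homogeneous_fin_two` (`TorusBKMGradientLogBoundPlanar`): the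
logarithm's argument is then `log(1 + √2 e^{8Λ(t−a)}(…)/Ω)`, linear in `Λ(t − a)` — no `ν⁻¹`.
[cite: MajdaBertozzi2002, §3.2 Prop. 3.7 with §4.4 (BKM-type gradient control; here the linearised planar form)] -/
theorem linearisedNSForced_sqrt_gradNormSq_laplacian_le_fin_two
    (hu : Torus.IsSmoothSpaceTimeOn (Icc a b) u) (hudiv : ∀ t ∈ Icc a b, Torus.IsDivFree (u t))
    (hw : Torus.IsSmoothSpaceTimeOn (Icc a b) w) (hq : Torus.IsSmoothSpaceTimeOn (Icc a b) q)
    (hwdiv : ∀ t ∈ Icc a b, Torus.IsDivFree (w t))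
    (hlin : ∀ t ∈ Icc a b, ∀ x, Torus.timeDerivWithin (Icc a b) w t x + Torus.convect (u t) (w t) x +
      Torus.convect (w t) (u t) x = ν • Torus.laplacian (w t) x - Torus.gradient (q t) x + g t x)
    (hab : a < b) (hν : 0 ≤ ν) {Λ L₂ : ℝ} (hΛ : 0 ≤ Λ) (hL₂ : 0 ≤ L₂)
    (hL : ∀ τ ∈ Icc a b, ∀ x, ∀ k, ‖Torus.partialDeriv k (u τ) x‖ ≤ Λ)
    (hLL : ∀ τ ∈ Icc a b, ∀ x, ∀ i k, ‖Torus.partialDeriv i (Torus.partialDeriv k (u τ)) x‖ ≤ L₂)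
    {Y : ℝ → ℝ} (hYc : ContinuousOn Y (Icc a b))
    (hY : ∀ τ ∈ Icc a b, Real.sqrt (scalarGradNormSq (torusVorticityTensor (w τ) 0 1)) ≤ Y τ)
    {G : ℝ → ℝ} (hGc : ContinuousOn G (Icc a b)) (hG0 : ∀ τ ∈ Icc a b, 0 ≤ G τ)
    (hsG : ∀ τ ∈ Icc a b, Real.sqrt (∑ i, ∑ k, ∫ x, (Torus.partialDeriv i (Torus.partialDeriv k (fun y =>
      (Torus.partialDeriv 0 (g τ) y 1 - Torus.partialDeriv 1 (g τ) y 0) -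
        ⟪w τ y, Torus.gradient (torusVorticityTensor (u τ) 0 1) y⟫_ℝ)) x) ^ 2) ≤ G τ)
    {t : ℝ} (ht : t ∈ Icc a b) :
    Real.sqrt (Torus.gradNormSq (Torus.laplacian (w t))) ≤
      Real.sqrt 2 * (Real.exp (8 * Λ * (t - a)) *
        (Real.sqrt (∑ i, ∑ k, ∫ x,
            (Torus.partialDeriv i (Torus.partialDeriv k (torusVorticityTensor (w a) 0 1)) x) ^ 2) +
          ∫ τ in a..t, (4 * L₂ * Y τ + G τ))) := by
  have hwt : Torus.IsSmooth (w t) := hw.isSmooth_slice ht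
  have h1 := gradNormSq_laplacian_le_two_mul_sum_fin_two hwt (hwdiv t ht)
  have h2 := linearisedNSForced_sqrt_sum_vorticity_le_exp_fin_two hu hudiv hw hq hwdiv hlin hab hν hΛ hL₂
    hL hLL hYc hY hGc hG0 hsG ht
  have hS0 : 0 ≤ ∑ i, ∑ k, ∫ x,
      (Torus.partialDeriv i (Torus.partialDeriv k (torusVorticityTensor (w t) 0 1)) x) ^ 2 :=
    Finset.sum_nonneg fun i _ => Finset.sum_nonneg fun k _ => integral_nonneg fun x => sq_nonneg _
  calc Real.sqrt (Torus.gradNormSq (Torus.laplacian (w t)))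
      ≤ Real.sqrt (2 * ∑ i, ∑ k, ∫ x,
          (Torus.partialDeriv i (Torus.partialDeriv k (torusVorticityTensor (w t) 0 1)) x) ^ 2) :=
        Real.sqrt_le_sqrt h1
    _ = Real.sqrt 2 * Real.sqrt (∑ i, ∑ k, ∫ x,
          (Torus.partialDeriv i (Torus.partialDeriv k (torusVorticityTensor (w t) 0 1)) x) ^ 2) :=
        Real.sqrt_mul (by norm_num) _
    _ ≤ _ := mul_le_mul_of_nonneg_left h2 (Real.sqrt_nonneg _)

/-! ### Part 3. Components of a planar divergence-free field, measured by its vorticity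

For the cascade the vorticity source is `ρ · w₁` (`SawtoothCascadeResponseVorticity`); the product
bounds of `PassiveScalarForcedGradientGrowth` then ask for `‖w₁‖₂`, `‖∇w₁‖₂`, `(∑‖∂ᵢ∂ₖw₁‖₂²)^{1/2}`,
which for divergence-free planar `w` are at most `‖w‖₂`, `‖ω‖₂`, `‖∇ω‖₂`. -/

namespace LinearisedVorticityGrowth

/-- `∂ₖW₀₁(v) = W₀₁(∂ₖv)` for smooth `v` (mixed partials commute). [folklore] -/
private theorem partialDeriv_vorticity_eq_vorticity_partialDeriv {v : UnitAddTorus d → EuclideanSpace ℝ d}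
    (hv : Torus.IsSmooth v) (i j k : d) (x : UnitAddTorus d) :
    Torus.partialDeriv k (torusVorticityTensor v i j) x = torusVorticityTensor (Torus.partialDeriv k v) i j x := by
  have hi : Torus.IsContDiff 1 (fun y => Torus.partialDeriv i v y j) :=
    ((hv.partialDeriv i).apply j).isContDiff (by simp)
  have hj : Torus.IsContDiff 1 (fun y => -Torus.partialDeriv j v y i) :=
    ((hv.partialDeriv j).apply i).neg.isContDiff (by simp)
  have hfun : torusVorticityTensor v i j =
      (fun y => Torus.partialDeriv i v y j) + fun y => -Torus.partialDeriv j v y i := by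
    funext y; simp [torusVorticityTensor, sub_eq_add_neg]
  rw [hfun, Torus.partialDeriv_add hi hj k, Pi.add_apply, Torus.partialDeriv_neg,
    Torus.partialDeriv_apply_coord ((hv.partialDeriv i).isContDiff (by simp)),
    Torus.partialDeriv_apply_coord ((hv.partialDeriv j).isContDiff (by simp)),
    Torus.partialDeriv_comm hv k i, Torus.partialDeriv_comm hv k j, torusVorticityTensor]
  ring

/-- `‖∇φ‖²_{L²} = ∑ₖ ‖∂ₖφ‖²_{L²}` for smooth scalars. [folklore] -/
private theorem scalarGradNormSq_eq_sum' {φ : UnitAddTorus d → ℝ} (hφ : Torus.IsSmooth φ) :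
    scalarGradNormSq φ = ∑ k, ∫ x, (Torus.partialDeriv k φ x) ^ 2 := by
  unfold scalarGradNormSq
  simp_rw [norm_gradient_sq_eq_sum (hφ.isContDiff (by simp))]
  exact integral_finsetSum _ fun k _ => (((hφ.partialDeriv k).continuous).pow 2).integrable_unitAddTorus

/-- `‖∇v‖²_{L²} = ∑ᵢ ∫ ‖∂ᵢv‖²` (swap sum and integral in `gradNormSq`). [folklore] -/
private theorem gradNormSq_eq_sum {v : UnitAddTorus d → EuclideanSpace ℝ d} (hv : Torus.IsSmooth v) :
    Torus.gradNormSq v = ∑ i, ∫ x, ‖Torus.partialDeriv i v x‖ ^ 2 := by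
  unfold Torus.gradNormSq
  exact integral_finsetSum _ fun i _ => (((hv.partialDeriv i).continuous).norm.pow 2).integrable_unitAddTorus

end LinearisedVorticityGrowth

omit [DecidableEq d] in
/-- **`‖wⱼ‖₂ ≤ ‖w‖₂`**: a component is at most the field, in `L²` (continuous `w`). [cite: Evans2010, App. B.2 (elementary inequalities)] -/
theorem integral_apply_sq_le_integral_norm_sq {w : UnitAddTorus d → EuclideanSpace ℝ d}
    (hw : Torus.IsSmooth w) (j : d) : ∫ x, (w x j) ^ 2 ≤ ∫ x, ‖w x‖ ^ 2 := by
  have cj : Continuous fun x => w x j := (hw.apply j).continuous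
  refine integral_mono ((cj.pow 2).integrable_unitAddTorus) ((hw.continuous.norm.pow 2).integrable_unitAddTorus)
    fun x => ?_
  have h := PiLp.norm_apply_le (w x) j
  rw [Real.norm_eq_abs] at h
  calc (w x j) ^ 2 = |w x j| ^ 2 := (sq_abs _).symm
    _ ≤ ‖w x‖ ^ 2 := pow_le_pow_left₀ (abs_nonneg _) h 2

/-- **`‖∇wⱼ‖₂² ≤ ‖∇w‖₂²`** for smooth `w` (`∂ₖwⱼ = (∂ₖw)ⱼ`, componentwise). [cite: Evans2010, App. B.2 (elementary inequalities)] -/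
theorem scalarGradNormSq_apply_le_gradNormSq {w : UnitAddTorus d → EuclideanSpace ℝ d}
    (hw : Torus.IsSmooth w) (j : d) : scalarGradNormSq (fun x => w x j) ≤ Torus.gradNormSq w := by
  have hwj : Torus.IsSmooth (fun x => w x j) := hw.apply j
  rw [LinearisedVorticityGrowth.scalarGradNormSq_eq_sum' hwj, LinearisedVorticityGrowth.gradNormSq_eq_sum hw]
  refine Finset.sum_le_sum fun k _ => ?_
  refine integral_mono ((((hwj.partialDeriv k).continuous).pow 2).integrable_unitAddTorus)
    ((((hw.partialDeriv k).continuous).norm.pow 2).integrable_unitAddTorus) fun x => ?_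
  have e : Torus.partialDeriv k (fun y => w y j) x = Torus.partialDeriv k w x j :=
    Torus.partialDeriv_apply_coord (hw.isContDiff (by simp)) k x j
  rw [e]
  have h := PiLp.norm_apply_le (Torus.partialDeriv k w x) j
  rw [Real.norm_eq_abs] at h
  calc (Torus.partialDeriv k w x j) ^ 2 = |Torus.partialDeriv k w x j| ^ 2 := (sq_abs _).symm
    _ ≤ ‖Torus.partialDeriv k w x‖ ^ 2 := pow_le_pow_left₀ (abs_nonneg _) h 2

/-- **`‖∇wⱼ‖₂² ≤ ‖ω‖₂²` on `T²`** for smooth divergence-free `w` (`‖∇w‖₂² = ‖ω‖₂²`, tree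
`integral_vorticity_sq_eq_gradNormSq_fin_two`). [cite: AyalaProtas2017, eqs. (2.3)–(2.4)] -/
theorem scalarGradNormSq_apply_le_integral_vorticity_sq_fin_two
    {w : UnitAddTorus (Fin 2) → EuclideanSpace ℝ (Fin 2)} (hw : Torus.IsSmooth w) (hdiv : Torus.IsDivFree w)
    (j : Fin 2) : scalarGradNormSq (fun x => w x j) ≤ ∫ x, torusVorticityTensor w 0 1 x ^ 2 := by
  rw [integral_vorticity_sq_eq_gradNormSq_fin_two hw hdiv]
  exact scalarGradNormSq_apply_le_gradNormSq hw j

/-- **`∑ᵢₖ ‖∂ᵢ∂ₖwⱼ‖₂² ≤ ‖∇ω‖₂²` on `T²`** for smooth divergence-free `w`: componentwise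
`(∂ᵢ∂ₖw)ⱼ² ≤ ‖∂ᵢ∂ₖw‖²`, `∑ᵢ ∫‖∂ᵢ∂ₖw‖² = ‖∇(∂ₖw)‖₂² = ‖curl ∂ₖw‖₂² = ‖∂ₖω‖₂²` (`∂ₖw` is smooth and
divergence free) and `∑ₖ ‖∂ₖω‖₂² = ‖∇ω‖₂²`. [cite: AyalaProtas2017, eqs. (2.3)–(2.4)] -/
theorem sum_partialDeriv_partialDeriv_apply_sq_le_scalarGradNormSq_vorticity_fin_two
    {w : UnitAddTorus (Fin 2) → EuclideanSpace ℝ (Fin 2)} (hw : Torus.IsSmooth w) (hdiv : Torus.IsDivFree w)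
    (j : Fin 2) :
    ∑ i, ∑ k, ∫ x, (Torus.partialDeriv i (Torus.partialDeriv k (fun y => w y j)) x) ^ 2 ≤
      scalarGradNormSq (torusVorticityTensor w 0 1) := by
  have hω : Torus.IsSmooth (torusVorticityTensor w 0 1) :=
    ((hw.partialDeriv 0).apply 1).sub ((hw.partialDeriv 1).apply 0)
  -- componentwise identification of the integrand
  have e : ∀ i k x, Torus.partialDeriv i (Torus.partialDeriv k (fun y => w y j)) x =
      Torus.partialDeriv i (Torus.partialDeriv k w) x j := by
    intro i k x
    have e1 : Torus.partialDeriv k (fun y => w y j) = fun y => Torus.partialDeriv k w y j := by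
      funext y; exact Torus.partialDeriv_apply_coord (hw.isContDiff (by simp)) k y j
    rw [e1]
    exact Torus.partialDeriv_apply_coord ((hw.partialDeriv k).isContDiff (by simp)) i x j
  -- step 1: components ≤ norms
  have step1 : ∑ i, ∑ k, ∫ x, (Torus.partialDeriv i (Torus.partialDeriv k (fun y => w y j)) x) ^ 2 ≤
      ∑ i, ∑ k, ∫ x, ‖Torus.partialDeriv i (Torus.partialDeriv k w) x‖ ^ 2 := by
    refine Finset.sum_le_sum fun i _ => Finset.sum_le_sum fun k _ => ?_
    have hwj : Torus.IsSmooth (fun y => w y j) := hw.apply j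
    refine integral_mono (((((hwj.partialDeriv k).partialDeriv i).continuous).pow 2).integrable_unitAddTorus)
      (((((hw.partialDeriv k).partialDeriv i).continuous).norm.pow 2).integrable_unitAddTorus) fun x => ?_
    rw [e i k x]
    have h := PiLp.norm_apply_le (Torus.partialDeriv i (Torus.partialDeriv k w) x) j
    rw [Real.norm_eq_abs] at h
    calc (Torus.partialDeriv i (Torus.partialDeriv k w) x j) ^ 2
        = |Torus.partialDeriv i (Torus.partialDeriv k w) x j| ^ 2 := (sq_abs _).symm
      _ ≤ ‖Torus.partialDeriv i (Torus.partialDeriv k w) x‖ ^ 2 := pow_le_pow_left₀ (abs_nonneg _) h 2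
  -- step 2: `∑ᵢ ∫ ‖∂ᵢ∂ₖw‖² = gradNormSq (∂ₖw) = ∫ (∂ₖω)²`
  have step2 : ∀ k, ∑ i, ∫ x, ‖Torus.partialDeriv i (Torus.partialDeriv k w) x‖ ^ 2 =
      ∫ x, (Torus.partialDeriv k (torusVorticityTensor w 0 1) x) ^ 2 := by
    intro k
    have hwk : Torus.IsSmooth (Torus.partialDeriv k w) := hw.partialDeriv k
    rw [← LinearisedVorticityGrowth.gradNormSq_eq_sum hwk,
      ← integral_vorticity_sq_eq_gradNormSq_fin_two hwk (hdiv.partialDeriv_of_isSmooth hw k)]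
    refine integral_congr_ae (ae_of_all _ fun x => ?_)
    show torusVorticityTensor (Torus.partialDeriv k w) 0 1 x ^ 2 =
      Torus.partialDeriv k (torusVorticityTensor w 0 1) x ^ 2
    rw [LinearisedVorticityGrowth.partialDeriv_vorticity_eq_vorticity_partialDeriv hw 0 1 k x]
  have step3 : ∑ i, ∑ k, ∫ x, ‖Torus.partialDeriv i (Torus.partialDeriv k w) x‖ ^ 2 =
      scalarGradNormSq (torusVorticityTensor w 0 1) := by
    rw [Finset.sum_comm]
    simp_rw [step2]
    exact (LinearisedVorticityGrowth.scalarGradNormSq_eq_sum' hω).symm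
  exact step1.trans step3.le

/-! ### Part 4. The source bounds from sup norms of `∇Ω̄`, `∇²Ω̄`, `∇³Ω̄`, and the explicit
### growth of the Beale–Kato–Majda quantity -/

section Explicit

variable {a b ν : ℝ} {u w g : ℝ → UnitAddTorus (Fin 2) → EuclideanSpace ℝ (Fin 2)}
  {q : ℝ → UnitAddTorus (Fin 2) → ℝ}

/-- The planar linearised vorticity source as a sum: for `C¹` `Ω̄`,
`(curl g) − ⟪w, ∇Ω̄⟫ = (curl g) + ((−∂₀Ω̄)·w₀ + (−∂₁Ω̄)·w₁)`. [cite: ShvydkoyLatushkin2005, §2 (vorticity form of the linearised operator)] -/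
theorem vorticitySource_eq_add_fin_two {Ω c : UnitAddTorus (Fin 2) → ℝ}
    {v : UnitAddTorus (Fin 2) → EuclideanSpace ℝ (Fin 2)} (hΩ : Torus.IsContDiff 1 Ω) :
    (fun x => c x - ⟪v x, Torus.gradient Ω x⟫_ℝ) =
      fun x => c x + ((-Torus.partialDeriv 0 Ω x) * v x 0 + (-Torus.partialDeriv 1 Ω x) * v x 1) := by
  funext x
  rw [Torus.inner_gradient_eq_sum_mul_partialDeriv hΩ (v x) x, Fin.sum_univ_two]
  ring

/-- **`‖∇s‖₂` for the planar linearised vorticity source** `s = curl g − ⟪w, ∇Ω̄⟫`: if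
`|∂ₘΩ̄| ≤ K₁`, `|∂ₖ∂ₘΩ̄| ≤ K₂` pointwise (`K₁, K₂ ≥ 0`), `w` smooth and divergence free, then
`‖∇s‖₂ ≤ ‖∇ curl g‖₂ + 2 (K₁ ‖ω‖₂ + √2 K₂ ‖w‖₂)` (`ω = curl w`; product and sum rules of
`PassiveScalarForcedGradientGrowth`, components by Part 3).
[cite: MajdaBertozzi2002, §3.2 Prop. 3.7 (3.58)–(3.60) (calculus of the H^m energy estimate; linearised vorticity source)] -/
theorem sqrt_scalarGradNormSq_vorticitySource_le_fin_two {Ω c : UnitAddTorus (Fin 2) → ℝ}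
    {v : UnitAddTorus (Fin 2) → EuclideanSpace ℝ (Fin 2)} (hΩ : Torus.IsSmooth Ω) (hc : Torus.IsSmooth c)
    (hv : Torus.IsSmooth v) (hdiv : Torus.IsDivFree v) {K₁ K₂ : ℝ} (hK₁ : 0 ≤ K₁) (hK₂ : 0 ≤ K₂)
    (h1 : ∀ x m, |Torus.partialDeriv m Ω x| ≤ K₁)
    (h2 : ∀ x k m, |Torus.partialDeriv k (Torus.partialDeriv m Ω) x| ≤ K₂) :
    Real.sqrt (scalarGradNormSq (fun x => c x - ⟪v x, Torus.gradient Ω x⟫_ℝ)) ≤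
      Real.sqrt (scalarGradNormSq c) +
        2 * (K₁ * Real.sqrt (∫ x, torusVorticityTensor v 0 1 x ^ 2) +
          Real.sqrt 2 * K₂ * Real.sqrt (∫ x, ‖v x‖ ^ 2)) := by
  rw [vorticitySource_eq_add_fin_two (v := v) (c := c) (hΩ.isContDiff (by simp))]
  have hρ : ∀ m : Fin 2, Torus.IsSmooth (fun x => -Torus.partialDeriv m Ω x) := fun m => (hΩ.partialDeriv m).neg
  have hvm : ∀ m : Fin 2, Torus.IsSmooth (fun x => v x m) := fun m => hv.apply m
  have hP : ∀ m : Fin 2, Torus.IsSmooth (fun x => (-Torus.partialDeriv m Ω x) * v x m) := fun m =>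
    (hρ m).smul' (hvm m)
  have hsum : Torus.IsSmooth (fun x => (-Torus.partialDeriv 0 Ω x) * v x 0 + (-Torus.partialDeriv 1 Ω x) * v x 1) :=
    (hP 0).add (hP 1)
  -- bounds on `ρₘ = -∂ₘΩ̄`
  have hρ0 : ∀ m x, |(-Torus.partialDeriv m Ω x)| ≤ K₁ := fun m x => by rw [abs_neg]; exact h1 x m
  have hρ1 : ∀ m x k, |Torus.partialDeriv k (fun x => -Torus.partialDeriv m Ω x) x| ≤ K₂ := by
    intro m x k
    rw [Torus.partialDeriv_neg, abs_neg]
    exact h2 x k m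
  -- each product
  have hprod : ∀ m : Fin 2, Real.sqrt (scalarGradNormSq (fun x => (-Torus.partialDeriv m Ω x) * v x m)) ≤
      K₁ * Real.sqrt (∫ x, torusVorticityTensor v 0 1 x ^ 2) + Real.sqrt 2 * K₂ * Real.sqrt (∫ x, ‖v x‖ ^ 2) := by
    intro m
    have h := sqrt_scalarGradNormSq_mul_le (hρ m) (hvm m) hK₁ hK₂ (hρ0 m) (hρ1 m)
    have e2 : (Fintype.card (Fin 2) : ℝ) = 2 := by simp
    rw [e2] at h
    have c1 : Real.sqrt (scalarGradNormSq (fun x => v x m)) ≤ Real.sqrt (∫ x, torusVorticityTensor v 0 1 x ^ 2) :=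
      Real.sqrt_le_sqrt (scalarGradNormSq_apply_le_integral_vorticity_sq_fin_two hv hdiv m)
    have c2 : Real.sqrt (∫ x, (v x m) ^ 2) ≤ Real.sqrt (∫ x, ‖v x‖ ^ 2) :=
      Real.sqrt_le_sqrt (integral_apply_sq_le_integral_norm_sq hv m)
    have s2 : 0 ≤ Real.sqrt 2 := Real.sqrt_nonneg _
    nlinarith [h, c1, c2, mul_nonneg hK₁ (Real.sqrt_nonneg (∫ x, (v x m) ^ 2)),
      mul_nonneg (mul_nonneg s2 hK₂) (Real.sqrt_nonneg (∫ x, (v x m) ^ 2)),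
      mul_le_mul_of_nonneg_left c1 hK₁, mul_le_mul_of_nonneg_left c2 (mul_nonneg s2 hK₂)]
  have t1 := sqrt_scalarGradNormSq_add_le hc hsum
  have t2 := sqrt_scalarGradNormSq_add_le (hP 0) (hP 1)
  linarith [t1, t2, hprod 0, hprod 1]

/-- **`(∑‖∂ᵢ∂ₖs‖₂²)^{1/2}` for the planar linearised vorticity source** `s = curl g − ⟪w, ∇Ω̄⟫`: if
`|∂ₘΩ̄| ≤ K₁`, `|∂ₖ∂ₘΩ̄| ≤ K₂`, `|∂ᵢ∂ₖ∂ₘΩ̄| ≤ K₃` pointwise, `w` smooth and divergence free, then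
`(∑‖∂ᵢ∂ₖs‖₂²)^{1/2} ≤ (∑‖∂ᵢ∂ₖ curl g‖₂²)^{1/2} + 2 (K₁ ‖∇ω‖₂ + 2√2 K₂ ‖ω‖₂ + 2 K₃ ‖w‖₂)`.
[cite: MajdaBertozzi2002, §3.2 Prop. 3.7 (3.58)–(3.60) (calculus of the H^m energy estimate; linearised vorticity source)] -/
theorem sqrt_sum_vorticitySource_le_fin_two {Ω c : UnitAddTorus (Fin 2) → ℝ}
    {v : UnitAddTorus (Fin 2) → EuclideanSpace ℝ (Fin 2)} (hΩ : Torus.IsSmooth Ω) (hc : Torus.IsSmooth c)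
    (hv : Torus.IsSmooth v) (hdiv : Torus.IsDivFree v) {K₁ K₂ K₃ : ℝ} (hK₁ : 0 ≤ K₁) (hK₂ : 0 ≤ K₂)
    (hK₃ : 0 ≤ K₃) (h1 : ∀ x m, |Torus.partialDeriv m Ω x| ≤ K₁)
    (h2 : ∀ x k m, |Torus.partialDeriv k (Torus.partialDeriv m Ω) x| ≤ K₂)
    (h3 : ∀ x i k m, |Torus.partialDeriv i (Torus.partialDeriv k (Torus.partialDeriv m Ω)) x| ≤ K₃) :
    Real.sqrt (∑ i, ∑ k, ∫ x, (Torus.partialDeriv i (Torus.partialDeriv k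
        (fun x => c x - ⟪v x, Torus.gradient Ω x⟫_ℝ)) x) ^ 2) ≤
      Real.sqrt (∑ i, ∑ k, ∫ x, (Torus.partialDeriv i (Torus.partialDeriv k c) x) ^ 2) +
        2 * (K₁ * Real.sqrt (scalarGradNormSq (torusVorticityTensor v 0 1)) +
          2 * Real.sqrt 2 * K₂ * Real.sqrt (∫ x, torusVorticityTensor v 0 1 x ^ 2) +
          2 * K₃ * Real.sqrt (∫ x, ‖v x‖ ^ 2)) := by
  rw [vorticitySource_eq_add_fin_two (v := v) (c := c) (hΩ.isContDiff (by simp))]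
  have hρ : ∀ m : Fin 2, Torus.IsSmooth (fun x => -Torus.partialDeriv m Ω x) := fun m => (hΩ.partialDeriv m).neg
  have hvm : ∀ m : Fin 2, Torus.IsSmooth (fun x => v x m) := fun m => hv.apply m
  have hP : ∀ m : Fin 2, Torus.IsSmooth (fun x => (-Torus.partialDeriv m Ω x) * v x m) := fun m =>
    (hρ m).smul' (hvm m)
  have hsum : Torus.IsSmooth (fun x => (-Torus.partialDeriv 0 Ω x) * v x 0 + (-Torus.partialDeriv 1 Ω x) * v x 1) :=
    (hP 0).add (hP 1)
  have hρ0 : ∀ m x, |(-Torus.partialDeriv m Ω x)| ≤ K₁ := fun m x => by rw [abs_neg]; exact h1 x m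
  have hρ1 : ∀ m x k, |Torus.partialDeriv k (fun x => -Torus.partialDeriv m Ω x) x| ≤ K₂ := by
    intro m x k
    rw [Torus.partialDeriv_neg, abs_neg]
    exact h2 x k m
  have hρ2 : ∀ m x i k, |Torus.partialDeriv i (Torus.partialDeriv k (fun x => -Torus.partialDeriv m Ω x)) x| ≤ K₃ := by
    intro m x i k
    have e2 : Torus.partialDeriv k (fun x => -Torus.partialDeriv m Ω x) =
        fun y => -Torus.partialDeriv k (Torus.partialDeriv m Ω) y := by
      funext y; exact Torus.partialDeriv_neg k _ y
    rw [e2, Torus.partialDeriv_neg, abs_neg]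
    exact h3 x i k m
  have hprod : ∀ m : Fin 2, Real.sqrt (∑ i, ∑ k, ∫ x, (Torus.partialDeriv i (Torus.partialDeriv k
      (fun x => (-Torus.partialDeriv m Ω x) * v x m)) x) ^ 2) ≤
      K₁ * Real.sqrt (scalarGradNormSq (torusVorticityTensor v 0 1)) +
        2 * Real.sqrt 2 * K₂ * Real.sqrt (∫ x, torusVorticityTensor v 0 1 x ^ 2) +
        2 * K₃ * Real.sqrt (∫ x, ‖v x‖ ^ 2) := by
    intro m
    have h := sqrt_sum_partialDeriv_partialDeriv_mul_sq_le (hρ m) (hvm m) hK₁ hK₂ hK₃ (hρ0 m) (hρ1 m) (hρ2 m)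
    have e2 : (Fintype.card (Fin 2) : ℝ) = 2 := by simp
    rw [e2] at h
    have c0 : Real.sqrt (∑ i, ∑ k, ∫ x, (Torus.partialDeriv i (Torus.partialDeriv k (fun y => v y m)) x) ^ 2) ≤
        Real.sqrt (scalarGradNormSq (torusVorticityTensor v 0 1)) :=
      Real.sqrt_le_sqrt (sum_partialDeriv_partialDeriv_apply_sq_le_scalarGradNormSq_vorticity_fin_two hv hdiv m)
    have c1 : Real.sqrt (scalarGradNormSq (fun x => v x m)) ≤ Real.sqrt (∫ x, torusVorticityTensor v 0 1 x ^ 2) :=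
      Real.sqrt_le_sqrt (scalarGradNormSq_apply_le_integral_vorticity_sq_fin_two hv hdiv m)
    have c2 : Real.sqrt (∫ x, (v x m) ^ 2) ≤ Real.sqrt (∫ x, ‖v x‖ ^ 2) :=
      Real.sqrt_le_sqrt (integral_apply_sq_le_integral_norm_sq hv m)
    have s2 : 0 ≤ Real.sqrt 2 := Real.sqrt_nonneg _
    have m0 := mul_le_mul_of_nonneg_left c0 hK₁
    have m1 := mul_le_mul_of_nonneg_left c1 (by positivity : 0 ≤ 2 * Real.sqrt 2 * K₂)
    have m2 := mul_le_mul_of_nonneg_left c2 (by positivity : 0 ≤ 2 * K₃)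
    linarith [h, m0, m1, m2]
  have t1 := sqrt_sum_partialDeriv_partialDeriv_add_sq_le hc hsum
  have t2 := sqrt_sum_partialDeriv_partialDeriv_add_sq_le (hP 0) (hP 1)
  linarith [t1, t2, hprod 0, hprod 1]

/-- **Explicit, `ν`-uniform growth of the Beale–Kato–Majda quantity `‖∇Δw‖₂` along the planar
linearised flow, from sup norms of the background.** Let `(w, q)` be a classical divergence-free
solution of `∂ₜw + (u·∇)w + (w·∇)u = νΔw − ∇q + g` on `[a, b] × T²` (`ν ≥ 0`) along a smooth
divergence-free `u` with, on the window, `‖∂ₖu‖ ≤ Λ`, `‖∂ᵢ∂ₖu‖ ≤ L₂`, and for the background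
vorticity `Ω̄ = ∂₀u₁ − ∂₁u₀`: `|∂ₘΩ̄| ≤ K₁`, `|∂ₖ∂ₘΩ̄| ≤ K₂`, `|∂ᵢ∂ₖ∂ₘΩ̄| ≤ K₃`. Let continuous
majorants on `[a, b]` be given: `‖w(τ)‖₂ ≤ M(τ)`, `‖ω(τ)‖₂ ≤ Z(τ)` (`ω = ∂₀w₁ − ∂₁w₀`; e.g. from the
energy inequality and `linearisedNSForced_sqrt_integral_vorticity_sq_le_fin_two`),
`‖∇curl g(τ)‖₂ ≤ C₁(τ)`, `(∑‖∂ᵢ∂ₖ curl g(τ)‖₂²)^{1/2} ≤ C₂(τ)`, and continuous `G₁, Y, G₂` with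
`C₁ + 2(K₁Z + √2K₂M) ≤ G₁`, `e^{2Λ(τ−a)}(‖∇ω(a)‖₂ + ∫ₐ^τ G₁) ≤ Y(τ)`,
`C₂ + 2(K₁Y + 2√2K₂Z + 2K₃M) ≤ G₂` on `[a, b]`. Then for `t ∈ [a, b]`
`‖∇Δw(t)‖₂ ≤ √2 · e^{8Λ(t−a)} ((∑‖∂ᵢ∂ₖω(a)‖₂²)^{1/2} + ∫ₐᵗ (4L₂Y + G₂))`.
Chain: Part 4 source bounds ⇒ `linearisedNSForced_sqrt_scalarGradNormSq_vorticity_le_exp_fin_two`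
(`‖∇ω‖₂ ≤ Y`) ⇒ `linearisedNSForced_sqrt_gradNormSq_laplacian_le_fin_two`. No `ν⁻¹` anywhere.
[cite: MajdaBertozzi2002, §3.2 Prop. 3.7 (3.58)–(3.60) with §4.4 (H^m energy estimate uniform in the viscosity feeding a BKM-type gradient bound; linearised planar form)] -/
theorem linearisedNSForced_sqrt_gradNormSq_laplacian_le_explicit_fin_two
    (hu : Torus.IsSmoothSpaceTimeOn (Icc a b) u) (hudiv : ∀ t ∈ Icc a b, Torus.IsDivFree (u t))
    (hw : Torus.IsSmoothSpaceTimeOn (Icc a b) w) (hq : Torus.IsSmoothSpaceTimeOn (Icc a b) q)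
    (hwdiv : ∀ t ∈ Icc a b, Torus.IsDivFree (w t))
    (hlin : ∀ t ∈ Icc a b, ∀ x, Torus.timeDerivWithin (Icc a b) w t x + Torus.convect (u t) (w t) x +
      Torus.convect (w t) (u t) x = ν • Torus.laplacian (w t) x - Torus.gradient (q t) x + g t x)
    (hab : a < b) (hν : 0 ≤ ν) {Λ L₂ K₁ K₂ K₃ : ℝ} (hΛ : 0 ≤ Λ) (hL₂ : 0 ≤ L₂) (hK₁ : 0 ≤ K₁)
    (hK₂ : 0 ≤ K₂) (hK₃ : 0 ≤ K₃)
    (hL : ∀ τ ∈ Icc a b, ∀ x, ∀ k, ‖Torus.partialDeriv k (u τ) x‖ ≤ Λ)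
    (hLL : ∀ τ ∈ Icc a b, ∀ x, ∀ i k, ‖Torus.partialDeriv i (Torus.partialDeriv k (u τ)) x‖ ≤ L₂)
    (hK1 : ∀ τ ∈ Icc a b, ∀ x m, |Torus.partialDeriv m (torusVorticityTensor (u τ) 0 1) x| ≤ K₁)
    (hK2 : ∀ τ ∈ Icc a b, ∀ x k m,
      |Torus.partialDeriv k (Torus.partialDeriv m (torusVorticityTensor (u τ) 0 1)) x| ≤ K₂)
    (hK3 : ∀ τ ∈ Icc a b, ∀ x i k m, |Torus.partialDeriv i (Torus.partialDeriv k
      (Torus.partialDeriv m (torusVorticityTensor (u τ) 0 1))) x| ≤ K₃)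
    {M Z C₁ C₂ G₁ Y G₂ : ℝ → ℝ}
    (hM : ∀ τ ∈ Icc a b, Real.sqrt (∫ x, ‖w τ x‖ ^ 2) ≤ M τ)
    (hZ : ∀ τ ∈ Icc a b, Real.sqrt (∫ x, torusVorticityTensor (w τ) 0 1 x ^ 2) ≤ Z τ)
    (hC1 : ∀ τ ∈ Icc a b, Real.sqrt (scalarGradNormSq (fun x =>
      Torus.partialDeriv 0 (g τ) x 1 - Torus.partialDeriv 1 (g τ) x 0)) ≤ C₁ τ)
    (hC2 : ∀ τ ∈ Icc a b, Real.sqrt (∑ i, ∑ k, ∫ x, (Torus.partialDeriv i (Torus.partialDeriv k (fun y =>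
      Torus.partialDeriv 0 (g τ) y 1 - Torus.partialDeriv 1 (g τ) y 0)) x) ^ 2) ≤ C₂ τ)
    (hG1c : ContinuousOn G₁ (Icc a b)) (hYc : ContinuousOn Y (Icc a b)) (hG2c : ContinuousOn G₂ (Icc a b))
    (hG1 : ∀ τ ∈ Icc a b, C₁ τ + 2 * (K₁ * Z τ + Real.sqrt 2 * K₂ * M τ) ≤ G₁ τ)
    (hY : ∀ τ ∈ Icc a b, Real.exp (2 * Λ * (τ - a)) *
      (Real.sqrt (scalarGradNormSq (torusVorticityTensor (w a) 0 1)) + ∫ σ in a..τ, G₁ σ) ≤ Y τ)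
    (hG2 : ∀ τ ∈ Icc a b, C₂ τ + 2 * (K₁ * Y τ + 2 * Real.sqrt 2 * K₂ * Z τ + 2 * K₃ * M τ) ≤ G₂ τ)
    {t : ℝ} (ht : t ∈ Icc a b) :
    Real.sqrt (Torus.gradNormSq (Torus.laplacian (w t))) ≤
      Real.sqrt 2 * (Real.exp (8 * Λ * (t - a)) *
        (Real.sqrt (∑ i, ∑ k, ∫ x,
            (Torus.partialDeriv i (Torus.partialDeriv k (torusVorticityTensor (w a) 0 1)) x) ^ 2) +
          ∫ τ in a..t, (4 * L₂ * Y τ + G₂ τ))) := by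
  have hU : UniqueDiffOn ℝ (Icc a b) := uniqueDiffOn_Icc hab
  -- smoothness of the slices
  have hΩs : Torus.IsSmoothSpaceTimeOn (Icc a b) (fun t => torusVorticityTensor (u t) 0 1) :=
    isSmoothSpaceTimeOn_torusVorticityTensor hu hab 0 1
  have hgst := linearisedNSForced_isSmoothSpaceTimeOn_force hu hw hq hlin hab
  have hcst : Torus.IsSmoothSpaceTimeOn (Icc a b) (fun τ x =>
      Torus.partialDeriv 0 (g τ) x 1 - Torus.partialDeriv 1 (g τ) x 0) :=
    ((hgst.partialDeriv hU 0).apply 1).sub ((hgst.partialDeriv hU 1).apply 0)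
  -- nonnegativity of the majorants
  have hM0 : ∀ τ ∈ Icc a b, 0 ≤ M τ := fun τ hτ => (Real.sqrt_nonneg _).trans (hM τ hτ)
  have hZ0 : ∀ τ ∈ Icc a b, 0 ≤ Z τ := fun τ hτ => (Real.sqrt_nonneg _).trans (hZ τ hτ)
  have hC10 : ∀ τ ∈ Icc a b, 0 ≤ C₁ τ := fun τ hτ => (Real.sqrt_nonneg _).trans (hC1 τ hτ)
  have hC20 : ∀ τ ∈ Icc a b, 0 ≤ C₂ τ := fun τ hτ => (Real.sqrt_nonneg _).trans (hC2 τ hτ)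
  have s2 : 0 ≤ Real.sqrt 2 := Real.sqrt_nonneg _
  have hG10 : ∀ τ ∈ Icc a b, 0 ≤ G₁ τ := by
    intro τ hτ
    have := hG1 τ hτ
    nlinarith [hC10 τ hτ, mul_nonneg hK₁ (hZ0 τ hτ), mul_nonneg (mul_nonneg s2 hK₂) (hM0 τ hτ)]
  -- (i) the gradient of the source
  have hsG1 : ∀ τ ∈ Icc a b, Real.sqrt (scalarGradNormSq (fun x =>
      (Torus.partialDeriv 0 (g τ) x 1 - Torus.partialDeriv 1 (g τ) x 0) -
        ⟪w τ x, Torus.gradient (torusVorticityTensor (u τ) 0 1) x⟫_ℝ)) ≤ G₁ τ := by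
    intro τ hτ
    have h := sqrt_scalarGradNormSq_vorticitySource_le_fin_two (hΩs.isSmooth_slice hτ) (hcst.isSmooth_slice hτ)
      (hw.isSmooth_slice hτ) (hwdiv τ hτ) hK₁ hK₂ (hK1 τ hτ) (hK2 τ hτ)
    have m1 := mul_le_mul_of_nonneg_left (hZ τ hτ) hK₁
    have m2 := mul_le_mul_of_nonneg_left (hM τ hτ) (mul_nonneg s2 hK₂)
    linarith [h, hC1 τ hτ, hG1 τ hτ, m1, m2]
  -- (ii) the gradient of the vorticity
  have hY' : ∀ τ ∈ Icc a b, Real.sqrt (scalarGradNormSq (torusVorticityTensor (w τ) 0 1)) ≤ Y τ := by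
    intro τ hτ
    have h := linearisedNSForced_sqrt_scalarGradNormSq_vorticity_le_exp_fin_two hu hudiv hw hq hwdiv hlin hab hν
      hΛ hL hG1c hG10 hsG1 hτ
    exact h.trans (hY τ hτ)
  have hY0 : ∀ τ ∈ Icc a b, 0 ≤ Y τ := fun τ hτ => (Real.sqrt_nonneg _).trans (hY' τ hτ)
  have hG20 : ∀ τ ∈ Icc a b, 0 ≤ G₂ τ := by
    intro τ hτ
    have := hG2 τ hτ
    nlinarith [hC20 τ hτ, mul_nonneg hK₁ (hY0 τ hτ), mul_nonneg (mul_nonneg s2 hK₂) (hZ0 τ hτ),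
      mul_nonneg hK₃ (hM0 τ hτ)]
  -- (iii) the Hessian of the source
  have hsG2 : ∀ τ ∈ Icc a b, Real.sqrt (∑ i, ∑ k, ∫ x, (Torus.partialDeriv i (Torus.partialDeriv k (fun y =>
      (Torus.partialDeriv 0 (g τ) y 1 - Torus.partialDeriv 1 (g τ) y 0) -
        ⟪w τ y, Torus.gradient (torusVorticityTensor (u τ) 0 1) y⟫_ℝ)) x) ^ 2) ≤ G₂ τ := by
    intro τ hτ
    have h := sqrt_sum_vorticitySource_le_fin_two (hΩs.isSmooth_slice hτ) (hcst.isSmooth_slice hτ)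
      (hw.isSmooth_slice hτ) (hwdiv τ hτ) hK₁ hK₂ hK₃ (hK1 τ hτ) (hK2 τ hτ) (hK3 τ hτ)
    have m0 := mul_le_mul_of_nonneg_left (hY' τ hτ) hK₁
    have m1 := mul_le_mul_of_nonneg_left (hZ τ hτ) (by positivity : 0 ≤ 2 * Real.sqrt 2 * K₂)
    have m2 := mul_le_mul_of_nonneg_left (hM τ hτ) (by positivity : 0 ≤ 2 * K₃)
    linarith [h, hC2 τ hτ, hG2 τ hτ, m0, m1, m2]
  -- (iv) conclude
  exact linearisedNSForced_sqrt_gradNormSq_laplacian_le_fin_two hu hudiv hw hq hwdiv hlin hab hν hΛ hL₂ hL hLL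
    hYc hY' hG2c hG20 hsG2 ht

end Explicit

/-! ### Part 5. Planar kinematics of a divergence-free field: `ΔL = ∇⊥ω`

For smooth divergence-free `L : T² → ℝ²` with `ω = ∂₀L₁ − ∂₁L₀`: `(ΔL)₀ = −∂₁ω`, `(ΔL)₁ = ∂₀ω`,
hence `‖Δ(∂ⱼL)‖₂² = ‖∂ⱼ∂₀ω‖₂² + ‖∂ⱼ∂₁ω‖₂²`, and `‖∂ⱼL‖₂² ≤ ‖ω‖₂²`; `∂ⱼL` has zero mean
(tree `hasZeroMean_partialDeriv`). Requested by the line `lip-agmon` (Agmon on `∂ⱼL`). -/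

section Kinematics

/-- Divergence-free on `T²`, in components: `(∂₀L)₀ + (∂₁L)₁ = 0`. [cite: MajdaBertozzi2002, §2.1 (2.5)–(2.6) (planar incompressible kinematics)] -/
theorem partialDeriv_apply_add_eq_zero_of_isDivFree_fin_two
    {L : UnitAddTorus (Fin 2) → EuclideanSpace ℝ (Fin 2)} (hL : Torus.IsSmooth L) (hdiv : Torus.IsDivFree L)
    (x : UnitAddTorus (Fin 2)) :
    Torus.partialDeriv 0 L x 0 + Torus.partialDeriv 1 L x 1 = 0 := by
  have h := hdiv x
  unfold Torus.divergence at h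
  rw [Fin.sum_univ_two, Torus.partialDeriv_apply_coord (hL.isContDiff (by simp)),
    Torus.partialDeriv_apply_coord (hL.isContDiff (by simp))] at h
  exact h

/-- **`(ΔL)₀ = −∂₁ω` on `T²`** for smooth divergence-free `L`, `ω = ∂₀L₁ − ∂₁L₀`.
[cite: MajdaBertozzi2002, §2.1 (2.5)–(2.6) (ΔL = ∇⊥ω for planar incompressible fields; eq. (2.12))] -/
theorem laplacian_apply_zero_eq_neg_partialDeriv_vorticity_fin_two
    {L : UnitAddTorus (Fin 2) → EuclideanSpace ℝ (Fin 2)} (hL : Torus.IsSmooth L) (hdiv : Torus.IsDivFree L)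
    (x : UnitAddTorus (Fin 2)) :
    Torus.laplacian L x 0 = -Torus.partialDeriv 1 (torusVorticityTensor L 0 1) x := by
  -- `(ΔL)₀ = (∂₀∂₀L)₀ + (∂₁∂₁L)₀`
  have e0 : Torus.laplacian L x 0 =
      Torus.partialDeriv 0 (Torus.partialDeriv 0 L) x 0 + Torus.partialDeriv 1 (Torus.partialDeriv 1 L) x 0 := by
    rw [LinearisedVorticityGrowth.laplacian_apply_coord hL x 0,
      Torus.laplacian_eq_sum_partialDeriv_partialDeriv (hL.apply 0) x, Fin.sum_univ_two]
    have e : ∀ i, Torus.partialDeriv i (Torus.partialDeriv i (fun y => L y 0)) x =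
        Torus.partialDeriv i (Torus.partialDeriv i L) x 0 := by
      intro i
      have e1 : Torus.partialDeriv i (fun y => L y 0) = fun y => Torus.partialDeriv i L y 0 := by
        funext y; exact Torus.partialDeriv_apply_coord (hL.isContDiff (by simp)) i y 0
      rw [e1]
      exact Torus.partialDeriv_apply_coord ((hL.partialDeriv i).isContDiff (by simp)) i x 0
    rw [e 0, e 1]
  -- `∂₁ω = (∂₀∂₁L)₁ − (∂₁∂₁L)₀`
  have e1 : Torus.partialDeriv 1 (torusVorticityTensor L 0 1) x =
      Torus.partialDeriv 0 (Torus.partialDeriv 1 L) x 1 - Torus.partialDeriv 1 (Torus.partialDeriv 1 L) x 0 := by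
    rw [LinearisedVorticityGrowth.partialDeriv_vorticity_eq_vorticity_partialDeriv hL 0 1 1 x, torusVorticityTensor]
  -- div-free for `∂₀L`: `(∂₀∂₀L)₀ + (∂₁∂₀L)₁ = 0`, and `∂₁∂₀L = ∂₀∂₁L`
  have hd0 := partialDeriv_apply_add_eq_zero_of_isDivFree_fin_two (hL.partialDeriv 0)
    (hdiv.partialDeriv_of_isSmooth hL 0) x
  rw [Torus.partialDeriv_comm hL 1 0 x] at hd0
  rw [e0, e1]
  linarith

/-- **`(ΔL)₁ = ∂₀ω` on `T²`** for smooth divergence-free `L`, `ω = ∂₀L₁ − ∂₁L₀`.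
[cite: MajdaBertozzi2002, §2.1 (2.5)–(2.6) (ΔL = ∇⊥ω for planar incompressible fields; eq. (2.12))] -/
theorem laplacian_apply_one_eq_partialDeriv_vorticity_fin_two
    {L : UnitAddTorus (Fin 2) → EuclideanSpace ℝ (Fin 2)} (hL : Torus.IsSmooth L) (hdiv : Torus.IsDivFree L)
    (x : UnitAddTorus (Fin 2)) :
    Torus.laplacian L x 1 = Torus.partialDeriv 0 (torusVorticityTensor L 0 1) x := by
  have e0 : Torus.laplacian L x 1 =
      Torus.partialDeriv 0 (Torus.partialDeriv 0 L) x 1 + Torus.partialDeriv 1 (Torus.partialDeriv 1 L) x 1 := by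
    rw [LinearisedVorticityGrowth.laplacian_apply_coord hL x 1,
      Torus.laplacian_eq_sum_partialDeriv_partialDeriv (hL.apply 1) x, Fin.sum_univ_two]
    have e : ∀ i, Torus.partialDeriv i (Torus.partialDeriv i (fun y => L y 1)) x =
        Torus.partialDeriv i (Torus.partialDeriv i L) x 1 := by
      intro i
      have e1 : Torus.partialDeriv i (fun y => L y 1) = fun y => Torus.partialDeriv i L y 1 := by
        funext y; exact Torus.partialDeriv_apply_coord (hL.isContDiff (by simp)) i y 1
      rw [e1]
      exact Torus.partialDeriv_apply_coord ((hL.partialDeriv i).isContDiff (by simp)) i x 1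
    rw [e 0, e 1]
  have e1 : Torus.partialDeriv 0 (torusVorticityTensor L 0 1) x =
      Torus.partialDeriv 0 (Torus.partialDeriv 0 L) x 1 - Torus.partialDeriv 1 (Torus.partialDeriv 0 L) x 0 := by
    rw [LinearisedVorticityGrowth.partialDeriv_vorticity_eq_vorticity_partialDeriv hL 0 1 0 x, torusVorticityTensor]
  -- div-free for `∂₁L`: `(∂₀∂₁L)₀ + (∂₁∂₁L)₁ = 0`, and `∂₀∂₁L = ∂₁∂₀L`
  have hd1 := partialDeriv_apply_add_eq_zero_of_isDivFree_fin_two (hL.partialDeriv 1)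
    (hdiv.partialDeriv_of_isSmooth hL 1) x
  rw [Torus.partialDeriv_comm hL 0 1 x] at hd1
  rw [e0, e1]
  linarith

/-- **`‖Δ(∂ⱼL)‖₂² = ‖∂ⱼ∂₀ω‖₂² + ‖∂ⱼ∂₁ω‖₂²` on `T²`** for smooth divergence-free `L` (apply
`ΔL = ∇⊥ω` to the divergence-free field `∂ⱼL`, whose vorticity is `∂ⱼω`, and commute partials).
[cite: MajdaBertozzi2002, §2.1 (2.5)–(2.6) (planar incompressible kinematics)] -/
theorem integral_norm_laplacian_partialDeriv_sq_eq_fin_two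
    {L : UnitAddTorus (Fin 2) → EuclideanSpace ℝ (Fin 2)} (hL : Torus.IsSmooth L) (hdiv : Torus.IsDivFree L)
    (j : Fin 2) :
    ∫ x, ‖Torus.laplacian (Torus.partialDeriv j L) x‖ ^ 2 =
      (∫ x, (Torus.partialDeriv j (Torus.partialDeriv 0 (torusVorticityTensor L 0 1)) x) ^ 2) +
        ∫ x, (Torus.partialDeriv j (Torus.partialDeriv 1 (torusVorticityTensor L 0 1)) x) ^ 2 := by
  have hLj : Torus.IsSmooth (Torus.partialDeriv j L) := hL.partialDeriv j
  have hdivj : Torus.IsDivFree (Torus.partialDeriv j L) := hdiv.partialDeriv_of_isSmooth hL j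
  have hω : Torus.IsSmooth (torusVorticityTensor L 0 1) :=
    ((hL.partialDeriv 0).apply 1).sub ((hL.partialDeriv 1).apply 0)
  -- the vorticity of `∂ⱼL` is `∂ⱼω`
  have hWj : torusVorticityTensor (Torus.partialDeriv j L) 0 1 = Torus.partialDeriv j (torusVorticityTensor L 0 1) := by
    funext y
    exact (LinearisedVorticityGrowth.partialDeriv_vorticity_eq_vorticity_partialDeriv hL 0 1 j y).symm
  have hpt : ∀ x, ‖Torus.laplacian (Torus.partialDeriv j L) x‖ ^ 2 =
      (Torus.partialDeriv j (Torus.partialDeriv 0 (torusVorticityTensor L 0 1)) x) ^ 2 +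
        (Torus.partialDeriv j (Torus.partialDeriv 1 (torusVorticityTensor L 0 1)) x) ^ 2 := by
    intro x
    rw [EuclideanSpace.norm_sq_eq, Fin.sum_univ_two, Real.norm_eq_abs, Real.norm_eq_abs, sq_abs, sq_abs,
      laplacian_apply_zero_eq_neg_partialDeriv_vorticity_fin_two hLj hdivj x,
      laplacian_apply_one_eq_partialDeriv_vorticity_fin_two hLj hdivj x, hWj,
      Torus.partialDeriv_comm hω 1 j x, Torus.partialDeriv_comm hω 0 j x]
    ring
  simp_rw [hpt]
  exact integral_add ((((hω.partialDeriv 0).partialDeriv j).continuous.pow 2).integrable_unitAddTorus)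
    ((((hω.partialDeriv 1).partialDeriv j).continuous.pow 2).integrable_unitAddTorus)

/-- **`‖∂ⱼL‖₂² ≤ ‖ω‖₂²` on `T²`** for smooth divergence-free `L` (`∑ⱼ‖∂ⱼL‖₂² = ‖∇L‖₂² = ‖ω‖₂²`).
[cite: AyalaProtas2017, eqs. (2.3)–(2.4)] -/
theorem integral_norm_partialDeriv_sq_le_integral_vorticity_sq_fin_two
    {L : UnitAddTorus (Fin 2) → EuclideanSpace ℝ (Fin 2)} (hL : Torus.IsSmooth L) (hdiv : Torus.IsDivFree L)
    (j : Fin 2) :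
    ∫ x, ‖Torus.partialDeriv j L x‖ ^ 2 ≤ ∫ x, torusVorticityTensor L 0 1 x ^ 2 := by
  rw [integral_vorticity_sq_eq_gradNormSq_fin_two hL hdiv, LinearisedVorticityGrowth.gradNormSq_eq_sum hL]
  exact Finset.single_le_sum (f := fun i => ∫ x, ‖Torus.partialDeriv i L x‖ ^ 2)
    (fun i _ => integral_nonneg fun x => sq_nonneg _) (Finset.mem_univ j)

/-- `∂ⱼL` has zero mean (pointer to the tree lemma, planar field version). [cite: Evans2010, App. C.2 Thm. 1 (Gauss–Green; empty boundary)] -/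
theorem hasZeroMean_partialDeriv_fin_two {L : UnitAddTorus (Fin 2) → EuclideanSpace ℝ (Fin 2)}
    (hL : Torus.IsSmooth L) (j : Fin 2) : Torus.HasZeroMean (Torus.partialDeriv j L) :=
  Torus.hasZeroMean_partialDeriv hL j

end Kinematics

end Torus

end Literature.Analysis.FluidPDE
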